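import Literature.AlgebraicGeometry.Resolution.BlowupStrictTransform
import Literature.AlgebraicGeometry.Resolution.BlowupAlgebraDerivations
import HarnessLib

/-!
# The kernel of `A[I/b] → B[J/q(b)]`: saturation, and the strict transform of a hypersurface

Topic: `Literature/AlgebraicGeometry/Resolution`. Complements `BlowupStrictTransform.lean`, which
constructs, for a ring map `q : A → B` with `q(I) ⊆ J`, the map of affine blowup algebras
`blowupAlgebraMap q I J b : A[I/b] → B[J/q(b)]` (Görtz–Wedhorn I, proof of Prop. 13.96 (2), on the
chart `D₊(bt)`) and proves it surjective for `q` surjective with `J = q(I)`. Here its KERNEL is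
computed: it is the `b`-saturation of `(ker q) · A[I/b]` (`mem_ker_blowupAlgebraMap_iff`: `g ↦ 0`
iff `bᴺ g ∈ (ker q) A[I/b]` for some `N`; no hypothesis on `A`, `q`). For a HYPERSURFACE,
`ker q = (f)`, whose equation factors on the chart as `f = bⁿ f'` with `b` a prime element of
`A[I/b]` not dividing `f'`, the saturation is `(f')` (`ker_blowupAlgebraMap_eq_span`): **the chart
ring of the blow-up of `A/(f)` is `A[I/b]/(f')`**, `f'` the strict transform of the equation
(`quotientKerBlowupAlgebraMapEquiv`). This is the step "We get four charts … and equations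
`u = t₁u'`, `v = t₁v'`, `t₂ = t₁t₂'` and `u'v' - t₂' t₃ ⋯ t_s = 0`" of de Jong 1996, 4.27 (p. 76),
where `uv - t₁ ⋯ t_s = t₁² (u'v' - t₂' t₃ ⋯ t_s)` on the chart `t₁ ≠ 0`. Everything is PROVED.

* `blowupAlgebra.mapQuotient I a J` — abbreviation for the case `q = (A → A/J)`, `J ↦ I(A/J)`;
  `blowupAlgebraMap_gen` / `mapQuotient_gen` — the maps on the generators `x/b ↦ q(x)/q(b)`;
* `exists_pow_mul_eq_algebraMap`, `eq_zero_of_pow_mul_eq_zero` — every element of `A[I/b]` is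
  `r/bᴹ`; `b` is a non-zero-divisor of `A[I/b]`;
* `mem_ker_blowupAlgebraMap_iff` — the kernel is the `b`-saturation of `(ker q) A[I/b]`;
* `mem_span_singleton_of_prime_of_pow_mul_mem` — if `b` is prime in `A[I/b]`, `b ∤ f'` and
  `bᴺ g ∈ (f')` then `g ∈ (f')`;
* `ker_blowupAlgebraMap_eq_span`, `quotientKerBlowupAlgebraMapEquiv` — the hypersurface case.

## Sources

* U. Görtz, T. Wedhorn, *Algebraic Geometry I*, 2nd ed. (2020), Prop. 13.96 (2) and the
  paragraph after it, p. 416 (strict transform of a closed subscheme; the affine blowup algebra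
  `A[I/f] ⊆ A_f` of (13.19), p. 415). [GortzWedhorn2020]
* A. J. de Jong, *Smoothness, semi-stability and alterations*, Publ. Math. IHÉS 83 (1996), 4.27,
  p. 76. [DeJong1996]
-/

noncomputable section

open IsLocalization

namespace Literature.AlgebraicGeometry.Resolution

universe u

section General

variable {A B : Type u} [CommRing A] [CommRing B] (q : A →+* B) (I : Ideal A) (J : Ideal B)
  (b : A)

/-- `blowupAlgebraMap` on the generators: `x/b ↦ q(x)/q(b)`. [folklore] -/
theorem blowupAlgebraMap_gen (hIJ : I.map q ≤ J) (x : A) (hx : x ∈ I) :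
    blowupAlgebraMap q I J b hIJ (blowupAlgebra.gen I b x hx) =
      blowupAlgebra.gen J (q b) (q x) (hIJ (Ideal.mem_map_of_mem q hx)) :=
  Subtype.ext (by
    rw [coe_blowupAlgebraMap, blowupAlgebra.coe_gen, blowupAlgebra.coe_gen, map_mul,
      awayMap_algebraMap, awayMap_invSelf])

/-! ## The kernel: the `b`-saturation of `(ker q) A[I/b]` -/

/-- Every element of `A[I/b]` is `r/bᴹ` for some `r ∈ A`: `bᴹ · g = r`. [folklore] -/
theorem blowupAlgebra.exists_pow_mul_eq_algebraMap (g : blowupAlgebra I b) :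
    ∃ (M : ℕ) (r : A), algebraMap A (blowupAlgebra I b) b ^ M * g =
      algebraMap A (blowupAlgebra I b) r := by
  obtain ⟨⟨r, ⟨_, M, rfl⟩⟩, h⟩ := IsLocalization.surj (Submonoid.powers b) (g : Localization.Away b)
  refine ⟨M, r, Subtype.ext ?_⟩
  change algebraMap A (Localization.Away b) b ^ M * (g : Localization.Away b) =
    algebraMap A (Localization.Away b) r
  rw [← map_pow, mul_comm]
  exact h

/-- `b` is a non-zero-divisor of `A[I/b]`, so `bᴺ z = 0` forces `z = 0`. [folklore] -/
theorem blowupAlgebra.eq_zero_of_pow_mul_eq_zero {N : ℕ} {z : blowupAlgebra I b}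
    (h : algebraMap A (blowupAlgebra I b) b ^ N * z = 0) : z = 0 := by
  have hreg := algebraMap_mem_nonZeroDivisors_blowupAlgebra (I := I) (a := b)
  exact (mul_left_mem_nonZeroDivisors_eq_zero_iff (pow_mem hreg N)).mp h

/-- **The kernel of `A[I/b] → B[J/q(b)]` is the `b`-saturation of `(ker q) A[I/b]`**: `g ↦ 0` iff
`bᴺ g ∈ (ker q) A[I/b]` for some `N` (write `g = r/bᴹ`; `q(r)/1 = 0` in `B[1/q(b)]` means
`q(b)ᴷ q(r) = 0`, i.e. `bᴷ r ∈ ker q`; conversely `q(b)` is a non-zero-divisor of `B[J/q(b)]`).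
[folklore] -/
theorem mem_ker_blowupAlgebraMap_iff (hIJ : I.map q ≤ J) (g : blowupAlgebra I b) :
    g ∈ RingHom.ker (blowupAlgebraMap q I J b hIJ) ↔
      ∃ N : ℕ, algebraMap A (blowupAlgebra I b) b ^ N * g ∈
        (RingHom.ker q).map (algebraMap A (blowupAlgebra I b)) := by
  constructor
  · intro hg
    rw [RingHom.mem_ker] at hg
    obtain ⟨M, r, hr⟩ := blowupAlgebra.exists_pow_mul_eq_algebraMap I b g
    -- `q(r)/1 = 0` in `B[1/q(b)]`, so `q(b)ᴷ q(r) = 0`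
    have h1 : blowupAlgebraMap q I J b hIJ (algebraMap A (blowupAlgebra I b) r) = 0 := by
      rw [← hr, map_mul, hg, mul_zero]
    rw [blowupAlgebraMap_algebraMap] at h1
    have h2 : algebraMap B (Localization.Away (q b)) (q r) = 0 := by
      have := congrArg Subtype.val h1
      simpa using this
    rw [IsLocalization.map_eq_zero_iff (Submonoid.powers (q b))] at h2
    obtain ⟨⟨_, K, rfl⟩, hK⟩ := h2
    dsimp only at hK
    rw [← map_pow, ← map_mul, ← RingHom.mem_ker] at hK
    refine ⟨K + M, ?_⟩
    rw [pow_add, mul_assoc, hr, ← map_pow, ← map_mul]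
    exact Ideal.mem_map_of_mem _ hK
  · rintro ⟨N, hN⟩
    rw [RingHom.mem_ker]
    -- apply the map: `ker q` dies, so `q(b)ᴺ · (image of g) = 0`
    have h1 : blowupAlgebraMap q I J b hIJ (algebraMap A (blowupAlgebra I b) b ^ N * g) = 0 := by
      have hle : (RingHom.ker q).map (algebraMap A (blowupAlgebra I b)) ≤
          RingHom.ker (blowupAlgebraMap q I J b hIJ) := by
        rw [Ideal.map_le_iff_le_comap]
        intro j hj
        rw [Ideal.mem_comap, RingHom.mem_ker, blowupAlgebraMap_algebraMap,
          RingHom.mem_ker.mp hj, map_zero]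
      exact hle hN
    rw [map_mul, map_pow, blowupAlgebraMap_algebraMap] at h1
    exact blowupAlgebra.eq_zero_of_pow_mul_eq_zero J (q b) h1

/-! ## The hypersurface case: the kernel is generated by the strict transform of the equation -/

variable {I b}

/-- If `b` is a prime element of `A[I/b]`, `b ∤ f'`, and `bᴺ g ∈ (f')`, then `g ∈ (f')`: peel off
one `b` at a time — `b · (bᴺ⁻¹ g) = f' h` forces `b ∣ h`, and `b` is cancellable, being a
non-zero-divisor of `A[I/b]` (`algebraMap_mem_nonZeroDivisors_blowupAlgebra`). [folklore] -/
theorem blowupAlgebra.mem_span_singleton_of_prime_of_pow_mul_mem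
    (hprime : Prime (algebraMap A (blowupAlgebra I b) b)) {f' : blowupAlgebra I b}
    (hndvd : ¬ algebraMap A (blowupAlgebra I b) b ∣ f') {N : ℕ} {g : blowupAlgebra I b}
    (hg : algebraMap A (blowupAlgebra I b) b ^ N * g ∈ Ideal.span {f'}) :
    g ∈ Ideal.span {f'} := by
  induction N with
  | zero => simpa using hg
  | succ N ih =>
    apply ih
    rw [Ideal.mem_span_singleton] at hg ⊢
    obtain ⟨h, hh⟩ := hg
    -- `b ∣ f' h`, so `b ∣ h`
    have hdvd : algebraMap A (blowupAlgebra I b) b ∣ f' * h :=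
      ⟨algebraMap A (blowupAlgebra I b) b ^ N * g, by rw [← hh]; ring⟩
    obtain ⟨h₁, rfl⟩ := (hprime.dvd_or_dvd hdvd).resolve_left hndvd
    refine ⟨h₁, ?_⟩
    have hreg := algebraMap_mem_nonZeroDivisors_blowupAlgebra (I := I) (a := b)
    refine (mul_cancel_left_mem_nonZeroDivisors hreg).mp ?_
    linear_combination hh

/-- **The chart ring of the blow-up of a hypersurface**: if `ker q = (f)` and `f = bⁿ · f'` in
`A[I/b]` with `b` prime in `A[I/b]` and `b ∤ f'`, then the kernel of `A[I/b] → B[J/q(b)]` is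
`(f')` — the `b`-saturation of `(f) = (bⁿ f')` is `(f')`.
[cite: GortzWedhorn2020, Prop. 13.96 (2) and p. 416] -/
theorem ker_blowupAlgebraMap_eq_span (hIJ : I.map q ≤ J) {f : A} (hker : RingHom.ker q = Ideal.span {f})
    {n : ℕ} {f' : blowupAlgebra I b}
    (hf : algebraMap A (blowupAlgebra I b) f = algebraMap A (blowupAlgebra I b) b ^ n * f')
    (hprime : Prime (algebraMap A (blowupAlgebra I b) b))
    (hndvd : ¬ algebraMap A (blowupAlgebra I b) b ∣ f') :
    RingHom.ker (blowupAlgebraMap q I J b hIJ) = Ideal.span {f'} := by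
  apply le_antisymm
  · intro g hg
    obtain ⟨N, hN⟩ := (mem_ker_blowupAlgebraMap_iff q I J b hIJ g).mp hg
    rw [hker, Ideal.map_span, Set.image_singleton, hf] at hN
    have hle : Ideal.span {algebraMap A (blowupAlgebra I b) b ^ n * f'} ≤ Ideal.span {f'} :=
      Ideal.span_singleton_le_span_singleton.mpr (dvd_mul_left f' _)
    exact blowupAlgebra.mem_span_singleton_of_prime_of_pow_mul_mem hprime hndvd (N := N) (hle hN)
  · rw [Ideal.span_le, Set.singleton_subset_iff, SetLike.mem_coe,
      mem_ker_blowupAlgebraMap_iff q I J b hIJ f']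
    refine ⟨n, ?_⟩
    rw [← hf, hker, Ideal.map_span, Set.image_singleton]
    exact Ideal.subset_span rfl

/-- **`A[I/b]/(f') ≅ B[J/q(b)]`** for `q` surjective with `J = q(I)` and `ker q = (f)`, under the
hypotheses of `ker_blowupAlgebraMap_eq_span`: the chart `D₊(bt)` of the blow-up of the hypersurface
`V(f)` along `I` is cut out of the chart `Spec A[I/b]` of the blow-up of `Spec A` by the strict
transform `f'` of the equation. [cite: GortzWedhorn2020, Prop. 13.96 (2) and p. 416] -/
def quotientKerBlowupAlgebraMapEquiv (hq : Function.Surjective q) (hIJ : I.map q ≤ J)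
    (hJI : J ≤ I.map q) {f : A} (hker : RingHom.ker q = Ideal.span {f}) {n : ℕ}
    {f' : blowupAlgebra I b}
    (hf : algebraMap A (blowupAlgebra I b) f = algebraMap A (blowupAlgebra I b) b ^ n * f')
    (hprime : Prime (algebraMap A (blowupAlgebra I b) b))
    (hndvd : ¬ algebraMap A (blowupAlgebra I b) b ∣ f') :
    (blowupAlgebra I b ⧸ Ideal.span {f'}) ≃+* blowupAlgebra J (q b) :=
  (Ideal.quotEquivOfEq (ker_blowupAlgebraMap_eq_span q J hIJ hker hf hprime hndvd).symm).trans
    (RingHom.quotientKerEquivOfSurjective (blowupAlgebraMap_surjective q I J b hq hIJ hJI))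

/-- The isomorphism on classes. [folklore] -/
@[simp]
theorem quotientKerBlowupAlgebraMapEquiv_mk (hq : Function.Surjective q) (hIJ : I.map q ≤ J)
    (hJI : J ≤ I.map q) {f : A} (hker : RingHom.ker q = Ideal.span {f}) {n : ℕ}
    {f' : blowupAlgebra I b}
    (hf : algebraMap A (blowupAlgebra I b) f = algebraMap A (blowupAlgebra I b) b ^ n * f')
    (hprime : Prime (algebraMap A (blowupAlgebra I b) b))
    (hndvd : ¬ algebraMap A (blowupAlgebra I b) b ∣ f') (g : blowupAlgebra I b) :
    quotientKerBlowupAlgebraMapEquiv q J hq hIJ hJI hker hf hprime hndvd (Ideal.Quotient.mk _ g) =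
      blowupAlgebraMap q I J b hIJ g :=
  rfl

end General

/-! ## The case of a quotient map `A → A/J` -/

namespace blowupAlgebra

variable {R : Type u} [CommRing R] (I : Ideal R) (a : R) (J : Ideal R)

/-- The map `R[I/a] → (R/J)[Ī/ā]`, `Ī = I (R/J)`, induced by `R → R/J` (`blowupAlgebraMap` of
`BlowupStrictTransform.lean` for the quotient map). [cite: GortzWedhorn2020, Prop. 13.96 (2) (proof), p. 416] -/
abbrev mapQuotient : blowupAlgebra I a →+*
    blowupAlgebra (I.map (Ideal.Quotient.mk J)) (Ideal.Quotient.mk J a) :=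
  blowupAlgebraMap (Ideal.Quotient.mk J) I (I.map (Ideal.Quotient.mk J)) a le_rfl

/-- `mapQuotient` on `R`: `r ↦ r̄`. [folklore] -/
theorem mapQuotient_algebraMap (r : R) :
    mapQuotient I a J (algebraMap R (blowupAlgebra I a) r) =
      algebraMap (R ⧸ J) _ (Ideal.Quotient.mk J r) :=
  blowupAlgebraMap_algebraMap _ _ _ _ _ r

/-- `mapQuotient` on the generators: `x/a ↦ x̄/ā`. [folklore] -/
theorem mapQuotient_gen (x : R) (hx : x ∈ I) :
    mapQuotient I a J (blowupAlgebra.gen I a x hx) =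
      blowupAlgebra.gen (I.map (Ideal.Quotient.mk J)) (Ideal.Quotient.mk J a)
        (Ideal.Quotient.mk J x) (Ideal.mem_map_of_mem _ hx) :=
  blowupAlgebraMap_gen _ _ _ _ _ x hx

/-- `mapQuotient` is surjective. [cite: GortzWedhorn2020, Prop. 13.96 (2) (proof), p. 416] -/
theorem mapQuotient_surjective : Function.Surjective (mapQuotient I a J) :=
  blowupAlgebraMap_surjective _ _ _ a Ideal.Quotient.mk_surjective le_rfl le_rfl

/-- The kernel of `R[I/a] → (R/J)[Ī/ā]` is the `a`-saturation of `J R[I/a]`. [folklore] -/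
theorem mem_ker_mapQuotient_iff (g : blowupAlgebra I a) :
    g ∈ RingHom.ker (mapQuotient I a J) ↔
      ∃ N : ℕ, algebraMap R (blowupAlgebra I a) a ^ N * g ∈
        J.map (algebraMap R (blowupAlgebra I a)) := by
  rw [mem_ker_blowupAlgebraMap_iff, Ideal.mk_ker]

/-- The hypersurface case for `R → R/(f)`: the kernel of `R[I/a] → (R/(f))[Ī/ā]` is `(f')` when
`f = aⁿ f'`, `a` prime in `R[I/a]`, `a ∤ f'`. [cite: GortzWedhorn2020, Prop. 13.96 (2) and p. 416] -/
theorem ker_mapQuotient_eq_span {f : R} {n : ℕ} {f' : blowupAlgebra I a}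
    (hf : algebraMap R (blowupAlgebra I a) f = algebraMap R (blowupAlgebra I a) a ^ n * f')
    (hprime : Prime (algebraMap R (blowupAlgebra I a) a))
    (hndvd : ¬ algebraMap R (blowupAlgebra I a) a ∣ f') :
    RingHom.ker (mapQuotient I a (Ideal.span {f})) = Ideal.span {f'} :=
  ker_blowupAlgebraMap_eq_span _ _ le_rfl Ideal.mk_ker hf hprime hndvd

/-- **`R[I/a]/(f') ≅ (R/(f))[Ī/ā]`**, the chart ring of the blow-up of the hypersurface `V(f)` as a
quotient of the chart ring of the blow-up of `Spec R`. [cite: GortzWedhorn2020, Prop. 13.96 (2) and p. 416] -/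
def quotientKerMapQuotientEquiv {f : R} {n : ℕ} {f' : blowupAlgebra I a}
    (hf : algebraMap R (blowupAlgebra I a) f = algebraMap R (blowupAlgebra I a) a ^ n * f')
    (hprime : Prime (algebraMap R (blowupAlgebra I a) a))
    (hndvd : ¬ algebraMap R (blowupAlgebra I a) a ∣ f') :
    (blowupAlgebra I a ⧸ Ideal.span {f'}) ≃+*
      blowupAlgebra (I.map (Ideal.Quotient.mk (Ideal.span {f})))
        (Ideal.Quotient.mk (Ideal.span {f}) a) :=
  quotientKerBlowupAlgebraMapEquiv _ _ Ideal.Quotient.mk_surjective le_rfl le_rfl Ideal.mk_ker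
    hf hprime hndvd

/-- The isomorphism on classes. [folklore] -/
@[simp]
theorem quotientKerMapQuotientEquiv_mk {f : R} {n : ℕ} {f' : blowupAlgebra I a}
    (hf : algebraMap R (blowupAlgebra I a) f = algebraMap R (blowupAlgebra I a) a ^ n * f')
    (hprime : Prime (algebraMap R (blowupAlgebra I a) a))
    (hndvd : ¬ algebraMap R (blowupAlgebra I a) a ∣ f') (g : blowupAlgebra I a) :
    quotientKerMapQuotientEquiv I a hf hprime hndvd (Ideal.Quotient.mk _ g) =
      mapQuotient I a (Ideal.span {f}) g :=
  rfl

end blowupAlgebra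

end Literature.AlgebraicGeometry.Resolution

end
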